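import Summits.BirchSwinnertonDyer.BirchSwinnertonDyer.Theorems.ResidualThetaTransportAtTwoSignedMuVanishingAtTwoPlusCuspSpanHeckeShimura
import Literature.NumberTheory.EllipticCurves.PAdicLFunctionIntegralityProofs
import Literature.NumberTheory.EllipticCurves.ModularityVersionApProofs
import Literature.NumberTheory.EllipticCurves.LFunctionPrimeCoeff
import Literature.NumberTheory.EllipticCurves.Rank1Residual.Predicates
import Summits.BirchSwinnertonDyer.Rank1Residual.Additive.PlusSymbolMinimalPeriod
import HarnessLib

/-!
# Route `ResidualThetaTransportAtTwo`, crux Kμ⁺ `SignedMuVanishingAtTwoPlus` (stmt-BirchSwinnertonDyer-20689),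
# line `birth`, stub `stub_flatMuZeroAtTwo`: THEOREM (R), steps (c)(d)(e) — the Hecke–Shimura lemma on
# period functionals and «the mod-2 plus character of a `T_p`-eigenform with `a_p ≢ p + 1 (mod 2)` does not
# factor through the lower-right entry»; hence the curve-free spanning hypothesis (G′)_N forces an ODD
# doubled plus period `2 re{∞, γ∞}_f / Ω⁺_f` at some `γ ∈ Γ₀(N)` with `d(γ) = ±4^k`, `k ≥ 1`

Cell `bsd-wall`, lead `bsd-wall-rtt-p4` g5 (helper for the registered stub `stub_flatMuZeroAtTwo : FlatMuZeroAtTwo` of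
`Cruxes/SignedMuVanishingAtTwoPlus/Lines/birth.lean`; THEOREMS ONLY — no `def`, no named fact, no `sorry`; nothing
about any curve is asserted beyond what is proved; BSD is not proved by this). Source of the argument: lead g4's crux
workfile `Cruxes/SignedMuVanishingAtTwoPlus/FlatCuspSpan.md` §2 (Theorem (R)); the width seat rtt-p4-w3 g2 types steps
(a)(b) (parity identity and `2[a/2^m]⁺_f ≡ χ_f(γ_{a/2^m}) (mod 2)`), this file types (c)(d)(e) in a currency that
needs no new definition:

* §1 = the companion file `…CuspSpanHeckeShimura` (f-free, Γ₀(N) only): `exists_cuspSymbol_heckeT_lowerRight` —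
  for a prime `p ∤ N` and `γ ∈ Γ₀(N)` the `p + 1` translates `δ₀, …, δ_{p−1}, δ'` of the tree's
  `exists_cuspSymbol_heckeT` can be chosen with `∏ⱼ d(δⱼ) · d(δ') = d(γ)^{p+1}` in `ZMod N`, `d` = lower-right
  entry: the `Γ₀(N)`-character form of «`T_p = p + 1` on the Shimura subgroup» (Ling–Oesterlé 1991 Thm 6, `p ∤ N`;
  Mazur 1977 II.11.7): KEY LEMMA (d) of the memo.
* §2 (one cusp form). For `f ∈ S₂(Γ₀(N))` with `Ω⁺_f ≠ 0` every period has `re{∞, γ∞}_f = m_γ · Ω⁺_f/2` with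
  `m_γ ∈ ℤ` (definition of `plusPeriod`: `re Λ_f = ℤ·Ω⁺_f/2`) and some `m_γ = 1`. `not_factorsThroughLowerRight`
  (R-core): if `T_p f = a f` (`p ∤ N` prime, `a ∈ ℤ`) with `a + p + 1` ODD, then `γ ↦ m_γ mod 2` is NOT of the form
  `ψ(d(γ))` for any `ψ : ZMod N → ZMod 2` multiplicative on units — by §1, `a · m_γ = ∑ⱼ m_{δⱼ} + m_{δ'}` would give
  `a ≡ (p+1) ψ(d(γ)) (mod 2)` at a `γ` with `m_γ = 1`, `ψ(d(γ)) = 1`. `exists_odd_re_cuspSymbol_of_cuspSpan` (R): under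
  the DUAL form of (G′)_N — every additive `ZMod 2`-character of `Γ₀(N)` that factors through the period homology
  and kills all `γ` with `|d(γ)| = 4^k`, `k ≥ 1`, factors through `d` — some `γ` with `|d(γ)| = 4^k` has `m_γ` odd.
* §3 (habitat⁺). `exists_odd_re_cuspSymbol_of_cuspSpan_of_goodSS`: for `W` good supersingular at `2` with
  `a₂(W) = 0` and its newform `f` (level `N_W`, odd), (G′)_{N_W} ⟹ ∃ `γ ∈ Γ₀(N_W)`, `|d(γ)| = 4^k` (`k ≥ 1`),
  `2 re{∞, γ∞}_f / Ω⁺_f` odd. The witness prime is `p = 2` itself (`T₂ f = a₂ f = 0`, `0 + 2 + 1` odd): step (e)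
  of the memo needs NO Chebotarev argument on the habitat.

What (G′)_N is and is not: it is an `f`-free, finite, per-level statement about `X₀(N)` (verified by exact
`𝔽₂`-linear algebra for all 1493 odd `N ≤ 2999` with `g ≥ 1` and the five smallest habitat⁺ conductors, memo §4;
kit job j295333 for all 147 habitat⁺ conductors); it is OPEN for infinite families and is not asserted here — it is a
HYPOTHESIS (`hG`) of the theorems of §§2–3, spelled inline (no definition is introduced).

References: S. Ling, J. Oesterlé, *The Shimura subgroup of `J₀(N)`*, Astérisque 196–197 (1991), Thm 6
[LingOesterle1991]; B. Mazur, *Modular curves and the Eisenstein ideal*, Publ. IHÉS 47 (1977), II.11.7 [Mazur1977];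
J. E. Cremona, *Algorithms for modular elliptic curves* (1997), §2.4 (2.4.1)–(2.4.2), §2.8 [CremonaAlgorithms1997];
R. Pollack, Duke Math. J. 118 (2003), Conj. 6.3 [Pollack2003].
-/

set_option autoImplicit false
set_option linter.dupNamespace false

noncomputable section

open scoped Classical MatrixGroups ModularForm

open CongruenceSubgroup WeierstrassCurve Literature.NumberTheory.EllipticCurves
  Literature.NumberTheory.EllipticCurves.ModularForms Literature.NumberTheory.EllipticCurves.Rank1Residual

namespace Summit.BirchSwinnertonDyer.BirchSwinnertonDyer.Theorems.SignedMuAtTwo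

/-! ## §2. The mod-2 plus character of a `T_p`-eigenform does not factor through the lower-right entry -/

section PlusCharacter

variable {N : ℕ} (f : CuspForm (Gamma0 N) 2)

/-- **Integrality of the doubled plus periods.** If `Ω⁺_f ≠ 0` then every period has
`re {∞, γ∞}_f = m · Ω⁺_f/2` with `m ∈ ℤ` (definition of `plusPeriod`: `re Λ_f = ℤ · Ω⁺_f/2`). [folklore] -/
theorem exists_int_re_cuspSymbol_eq (hΩ : plusPeriod f ≠ 0) (γ : Gamma0 N) :
    ∃ m : ℤ, (cuspSymbol f γ).re = m * (plusPeriod f / 2) := by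
  have hre : (cuspSymbol f γ).re ∈ realPeriods f :=
    AddSubgroup.mem_map_of_mem _ (cuspSymbol_mem_periodLattice f γ)
  rw [(realPeriods_eq_zmultiples_of_plusPeriod_ne_zero f hΩ).1, AddSubgroup.mem_zmultiples_iff] at hre
  obtain ⟨m, hm⟩ := hre
  exact ⟨m, by rw [← hm, zsmul_eq_mul]⟩

/-- Uniqueness of the integer `m` with `x = m · Ω⁺_f/2` (`Ω⁺_f ≠ 0`). [folklore] -/
theorem int_eq_of_mul_plusPeriod_half_eq (hΩ : plusPeriod f ≠ 0) {m m' : ℤ}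
    (h : (m : ℝ) * (plusPeriod f / 2) = m' * (plusPeriod f / 2)) : m = m' := by
  have h2 : plusPeriod f / 2 ≠ 0 := div_ne_zero hΩ two_ne_zero
  exact_mod_cast mul_right_cancel₀ h2 h

/-- **Surjectivity of the doubled plus character**: some period has `re {∞, γ∞}_f = Ω⁺_f/2` EXACTLY (`Ω⁺_f/2`
generates `re Λ_f`, and `Λ_f` consists of the `{∞, γ∞}_f`, Manin). [folklore] -/
theorem exists_re_cuspSymbol_eq_plusPeriod_half [NeZero N] (hΩ : plusPeriod f ≠ 0) :
    ∃ γ : Gamma0 N, (cuspSymbol f γ).re = plusPeriod f / 2 := by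
  have hmem : plusPeriod f / 2 ∈ realPeriods f := by
    rw [(realPeriods_eq_zmultiples_of_plusPeriod_ne_zero f hΩ).1]
    exact AddSubgroup.mem_zmultiples _
  obtain ⟨z, hz, hzre⟩ := AddSubgroup.mem_map.mp hmem
  have hz' : z ∈ (periodLattice f : Set ℂ) := hz
  rw [coe_periodLattice_eq_range] at hz'
  obtain ⟨γ, rfl⟩ := hz'
  exact ⟨γ, hzre⟩

/-- For a character `ψ : ZMod N → ZMod 2` multiplicative on units: `ψ 1 = 0`. [folklore] -/
theorem map_one_eq_zero_of_mul_on_units {ψ : ZMod N → ZMod 2}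
    (hψ : ∀ x y : ZMod N, IsUnit x → IsUnit y → ψ (x * y) = ψ x + ψ y) : ψ 1 = 0 := by
  have h := hψ 1 1 isUnit_one isUnit_one
  rw [mul_one] at h
  have h2 : ψ 1 + ψ 1 = 0 := by
    rw [← two_mul]
    exact mul_eq_zero_of_left (by decide) _
  rw [← h2, ← h]

/-- For `ψ` multiplicative on units: `ψ (∏ⱼ xⱼ) = ∑ⱼ ψ xⱼ` over units `xⱼ`. [folklore] -/
theorem map_prod_eq_sum_of_mul_on_units {ψ : ZMod N → ZMod 2}
    (hψ : ∀ x y : ZMod N, IsUnit x → IsUnit y → ψ (x * y) = ψ x + ψ y) {ι : Type*} (s : Finset ι)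
    (x : ι → ZMod N) (hx : ∀ i ∈ s, IsUnit (x i)) : ψ (∏ i ∈ s, x i) = ∑ i ∈ s, ψ (x i) := by
  classical
  induction s using Finset.induction_on with
  | empty => simp [map_one_eq_zero_of_mul_on_units hψ]
  | insert i s hi ih =>
    rw [Finset.prod_insert hi, Finset.sum_insert hi,
      hψ _ _ (hx i (Finset.mem_insert_self i s))
        (Finset.prod_induction _ IsUnit (fun _ _ ↦ IsUnit.mul) isUnit_one
          fun j hj ↦ hx j (Finset.mem_insert_of_mem hj)),
      ih fun j hj ↦ hx j (Finset.mem_insert_of_mem hj)]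

/-- For `ψ` multiplicative on units: `ψ (x^n) = n • ψ x` for a unit `x`. [folklore] -/
theorem map_pow_eq_smul_of_mul_on_units {ψ : ZMod N → ZMod 2}
    (hψ : ∀ x y : ZMod N, IsUnit x → IsUnit y → ψ (x * y) = ψ x + ψ y) {x : ZMod N} (hx : IsUnit x) (n : ℕ) :
    ψ (x ^ n) = n • ψ x := by
  induction n with
  | zero => simp [map_one_eq_zero_of_mul_on_units hψ]
  | succ n ih => rw [pow_succ, hψ _ _ (hx.pow n) hx, ih, succ_nsmul]

/-- **(R-core) The mod-2 plus character of a `T_p`-eigenform with `a_p ≢ p + 1 (mod 2)` does not factor through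
the lower-right entry.** Let `f ∈ S₂(Γ₀(N))` with `Ω⁺_f ≠ 0`, `p ∤ N` prime, `T_p f = a·f` with `a ∈ ℤ` and
`a + p + 1` ODD. Then there is NO `ψ : ZMod N → ZMod 2`, multiplicative on units, with
`2 re{∞, γ∞}_f / Ω⁺_f ≡ ψ(d(γ)) (mod 2)` for all `γ ∈ Γ₀(N)`. Proof: at a `γ` with `2 re{∞,γ∞}/Ω⁺ = 1`
(`exists_re_cuspSymbol_eq_plusPeriod_half`) the Hecke–Shimura lemma (`exists_cuspSymbol_heckeT_lowerRight`)
and `T_p f = a f` give `a · 1 = ∑ⱼ m(δⱼ) + m(δ') ≡ ψ(∏ d(δⱼ) d(δ')) = ψ(d(γ)^{p+1}) = (p+1) ψ(d(γ)) = (p + 1)·1`,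
contradicting the parity of `a + p + 1`. (Theorem (R) of the crux workfile `FlatCuspSpan.md`, core step; for the
habitat⁺ take `p = 2`, `a = a₂ = 0`.) [cite: LingOesterle1991, Thm. 6 (character form, via §1)] [cite: CremonaAlgorithms1997, §2.4, §2.8] -/
theorem not_factorsThroughLowerRight [NeZero N] (hΩ : plusPeriod f ≠ 0) {p : ℕ} [NeZero p] (hp : p.Prime)
    (hpN : ¬ p ∣ N) {a : ℤ} (hT : heckeT (Gamma0 N) 2 p f = (a : ℂ) • f) (hpar : Odd (a + p + 1))
    (ψ : ZMod N → ZMod 2) (hψ : ∀ x y : ZMod N, IsUnit x → IsUnit y → ψ (x * y) = ψ x + ψ y)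
    (hχ : ∀ (γ : Gamma0 N) (m : ℤ), (cuspSymbol f γ).re = m * (plusPeriod f / 2) →
      (m : ZMod 2) = ψ ((((γ : SL(2, ℤ)) 1 1 : ℤ) : ZMod N))) : False := by
  obtain ⟨γ, hγ⟩ := exists_re_cuspSymbol_eq_plusPeriod_half f hΩ
  have hψγ : ψ ((((γ : SL(2, ℤ)) 1 1 : ℤ) : ZMod N)) = 1 := by
    have := hχ γ 1 (by rw [hγ]; push_cast; ring)
    simpa using this.symm
  obtain ⟨δ, δ', hsum, hprod⟩ := exists_cuspSymbol_heckeT_lowerRight (N := N) hp hpN γ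
  choose m hm using fun j : Fin p ↦ exists_int_re_cuspSymbol_eq f hΩ (δ j)
  obtain ⟨m', hm'⟩ := exists_int_re_cuspSymbol_eq f hΩ δ'
  -- `a · Ω⁺/2 = ∑ⱼ mⱼ Ω⁺/2 + m' Ω⁺/2`
  have hsumf := hsum f
  rw [hT, cuspSymbol_smul] at hsumf
  have hre := congrArg Complex.re hsumf
  rw [show ((a : ℂ)) = ((a : ℝ) : ℂ) by norm_cast, Complex.re_ofReal_mul, hγ, Complex.add_re, Complex.re_sum,
    hm'] at hre
  rw [Finset.sum_congr rfl fun j _ ↦ hm j] at hre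
  have hint : (a : ℤ) = ∑ j : Fin p, m j + m' := by
    have h2 : plusPeriod f / 2 ≠ 0 := div_ne_zero hΩ two_ne_zero
    have : ((a : ℤ) : ℝ) * (plusPeriod f / 2) = ((∑ j : Fin p, m j + m' : ℤ) : ℝ) * (plusPeriod f / 2) := by
      rw [hre]; push_cast; rw [add_mul, Finset.sum_mul]
    exact_mod_cast mul_right_cancel₀ h2 this
  -- reduce mod 2 and use `ψ`
  have hmod : ((a : ℤ) : ZMod 2) = ∑ j : Fin p, ψ ((((δ j : SL(2, ℤ)) 1 1 : ℤ) : ZMod N)) +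
      ψ ((((δ' : SL(2, ℤ)) 1 1 : ℤ) : ZMod N)) := by
    rw [hint]; push_cast
    rw [hχ δ' m' hm', Finset.sum_congr rfl fun j _ ↦ hχ (δ j) (m j) (hm j)]
  rw [← map_prod_eq_sum_of_mul_on_units hψ _ _ fun j _ ↦ isUnit_gamma0_apply_one_one (δ j),
    ← hψ _ _ (Finset.prod_induction _ IsUnit (fun _ _ ↦ IsUnit.mul) isUnit_one
      fun j _ ↦ isUnit_gamma0_apply_one_one (δ j)) (isUnit_gamma0_apply_one_one δ'),
    hprod, map_pow_eq_smul_of_mul_on_units hψ (isUnit_gamma0_apply_one_one γ), hψγ, nsmul_eq_mul,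
    mul_one] at hmod
  -- parity
  obtain ⟨k, hk⟩ := hpar
  have h2 : ((2 : ℤ) : ZMod 2) = 0 := by decide
  have := congrArg (fun z : ℤ ↦ (z : ZMod 2)) hk
  simp only [Int.cast_add, Int.cast_mul, Int.cast_one, Int.cast_natCast, h2, zero_mul, zero_add, hmod] at this
  revert this
  push_cast
  generalize ((p : ℕ) : ZMod 2) = q
  intro h
  have : q + 1 + q + 1 = (q + 1) * 2 := by ring
  rw [this] at h
  exact absurd h (by rw [show (2 : ZMod 2) = 0 by decide, mul_zero]; decide)

/-- **(R) An odd doubled plus period on a `4^k`-class, from the curve-free spanning hypothesis (G′)_N.**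
Let `f ∈ S₂(Γ₀(N))` with `Ω⁺_f ≠ 0` and `T_p f = a f` for a prime `p ∤ N` with `a + p + 1` odd. ASSUME the dual
form of (G′)_N (`hG`): every map `χ : Γ₀(N) → ZMod 2` that is additive (`χ(γδ) = χ γ + χ δ`), factors through
the period homology (`{∞, γ∞} = {∞, δ∞}` as functionals ⟹ `χ γ = χ δ`; i.e. `χ ∈ H¹(X₀(N); 𝔽₂)`), and kills
every `γ` whose lower-right entry is `± 4^k`, `k ≥ 1` (the closed loops `{0 → b/4^k}`), factors through the
lower-right entry: `χ = ψ ∘ d` with `ψ : ZMod N → ZMod 2` multiplicative on units (i.e. `χ` comes from the Shimura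
quotient `(ℤ/N)^× / ±1`). THEN some `γ ∈ Γ₀(N)` with `|d(γ)| = 4^k`, `k ≥ 1`, has `2 re{∞, γ∞}_f / Ω⁺_f` ODD
(apply `hG` to `χ_f(γ) = 2 re{∞, γ∞}_f/Ω⁺_f mod 2` and conclude by `not_factorsThroughLowerRight`). This is
Theorem (R) of lead g4's `FlatCuspSpan.md` §2 in kernel form; (G′)_N itself is NOT asserted (hypothesis).
[cite: Pollack2003, Conj. 6.3 (μ⁻ = 0; (G′)_N is its curve-free homological shadow at p = 2)] [cite: CremonaAlgorithms1997, §2.4, §2.8] -/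
theorem exists_odd_re_cuspSymbol_of_cuspSpan [NeZero N] (hΩ : plusPeriod f ≠ 0) {p : ℕ} [NeZero p]
    (hp : p.Prime) (hpN : ¬ p ∣ N) {a : ℤ} (hT : heckeT (Gamma0 N) 2 p f = (a : ℂ) • f) (hpar : Odd (a + p + 1))
    (hG : ∀ χ : Gamma0 N → ZMod 2,
      (∀ γ δ : Gamma0 N, χ (γ * δ) = χ γ + χ δ) →
      (∀ γ δ : Gamma0 N, periodFunctional N γ = periodFunctional N δ → χ γ = χ δ) →
      (∀ γ : Gamma0 N, (∃ k : ℕ, 1 ≤ k ∧ ((γ : SL(2, ℤ)) 1 1).natAbs = 4 ^ k) → χ γ = 0) →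
      ∃ ψ : ZMod N → ZMod 2, (∀ x y : ZMod N, IsUnit x → IsUnit y → ψ (x * y) = ψ x + ψ y) ∧
        ∀ γ : Gamma0 N, χ γ = ψ ((((γ : SL(2, ℤ)) 1 1 : ℤ) : ZMod N))) :
    ∃ γ : Gamma0 N, (∃ k : ℕ, 1 ≤ k ∧ ((γ : SL(2, ℤ)) 1 1).natAbs = 4 ^ k) ∧
      ∃ m : ℤ, Odd m ∧ (cuspSymbol f γ).re = m * (plusPeriod f / 2) := by
  by_contra H
  push Not at H
  choose m hm using exists_int_re_cuspSymbol_eq f hΩ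
  -- the mod-2 plus character `χ_f`
  have hmul : ∀ γ δ : Gamma0 N, m (γ * δ) = m γ + m δ := by
    intro γ δ
    apply int_eq_of_mul_plusPeriod_half_eq f hΩ
    have h := cuspSymbol_mul_holds f γ δ
    have := congrArg Complex.re h
    rw [Complex.add_re, hm, hm, hm] at this
    rw [this]; push_cast; ring
  have hfac : ∀ γ δ : Gamma0 N, periodFunctional N γ = periodFunctional N δ → m γ = m δ := by
    intro γ δ h
    apply int_eq_of_mul_plusPeriod_half_eq f hΩ
    rw [← hm, ← hm, ← periodFunctional_apply N γ f, ← periodFunctional_apply N δ f, h]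
  have hkill : ∀ γ : Gamma0 N, (∃ k : ℕ, 1 ≤ k ∧ ((γ : SL(2, ℤ)) 1 1).natAbs = 4 ^ k) →
      ((m γ : ℤ) : ZMod 2) = 0 := by
    intro γ hγ
    have hne := H γ hγ (m γ)
    have heven : Even (m γ) := by
      by_contra hodd
      exact hne (Int.not_even_iff_odd.mp hodd) (hm γ)
    obtain ⟨r, hr⟩ := heven
    rw [hr]; push_cast
    rw [← two_mul]
    exact mul_eq_zero_of_left (by decide) _
  obtain ⟨ψ, hψ, hχψ⟩ := hG (fun γ ↦ ((m γ : ℤ) : ZMod 2)) (fun γ δ ↦ by simp only [hmul]; push_cast; rfl)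
    (fun γ δ h ↦ by simp only [hfac γ δ h]) hkill
  refine not_factorsThroughLowerRight f hΩ hp hpN hT hpar ψ hψ fun γ n hn ↦ ?_
  have : n = m γ := int_eq_of_mul_plusPeriod_half_eq f hΩ (by rw [← hn, hm])
  rw [this]
  exact hχψ γ

end PlusCharacter

/-! ## §3. The habitat⁺: witness prime `p = 2` (`T₂ f = a₂(W) f = 0`, `N_W` odd) — no Chebotarev -/

section Habitat

variable {W : WeierstrassCurve ℚ} [W.IsElliptic] [W.IsGloballyMinimal]

/-- On the habitat the level is odd: good reduction at `2` ⟹ `2 ∤ N_W`. [folklore] -/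
theorem not_two_dvd_conductorNorm_of_goodSS (hss : GoodSS W 2) : ¬ 2 ∣ W.conductorNorm ℤ := by
  rw [W.dvd_conductorNorm_iff_not_hasGoodReductionAtPrime 2, not_not]
  exact hss.1

/-- On the habitat the newform is killed by `T₂`: `T₂ f = a₂(W) • f = 0 • f`. [folklore] -/
theorem heckeT_two_eq_zero_smul_of_isNewformOf [NeZero (W.conductorNorm ℤ)]
    {f : CuspForm (Gamma0 (W.conductorNorm ℤ)) 2} (hf : IsNewformOf W f) (hss : GoodSS W 2)
    (ha : W.frobeniusTrace 2 = 0) :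
    heckeT (Gamma0 (W.conductorNorm ℤ)) 2 2 f = ((0 : ℤ) : ℂ) • f := by
  rw [IsNewform0.heckeT_eq_coeff_smul hf.1 Nat.prime_two]
  change cuspCoeff f 2 • f = _
  have hc : cuspCoeff f 2 = ((W.frobeniusTrace 2 : ℤ) : ℂ) := by
    rw [hf.2 2, W.LFunction_apply_prime_eq_frobeniusTrace 2 hss.1]
  rw [hc, ha]

/-- **Theorem (R) on the habitat⁺.** For `W/ℚ` good supersingular at `2` with `a₂(W) = 0` and its newform `f`
(level `N_W`): the dual spanning hypothesis (G′)_{N_W} (inline, as in `exists_odd_re_cuspSymbol_of_cuspSpan`)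
implies that some `γ ∈ Γ₀(N_W)` with lower-right entry `±4^k`, `k ≥ 1`, has `2 re{∞, γ∞}_f / Ω⁺_f` ODD. The
witness Hecke operator is `T₂` (`2 ∤ N_W`, eigenvalue `a₂ = 0 ≢ 2 + 1`), so step (e) of the crux memo needs no
Chebotarev argument. With the width seat's step (b) («`2[b/4^k]⁺_f ≡ 2 re{∞, γ∞}_f/Ω⁺_f (mod 2)` for
`γ·0 = b/4^k`, and `2`-integrality) this is a unit coefficient of the even Mazur–Tate layer `θ_{2k−2}(f)`, whence
FLAT at `(W, f)` by `not_two_dvd_flat_of_one_le_norm_coeff_mazurTateElement` (p578368). BSD is not proved by this;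
(G′)_{N_W} is a hypothesis. [cite: Pollack2003, Conj. 6.3] [cite: CremonaAlgorithms1997, §2.4, §2.8] -/
theorem exists_odd_re_cuspSymbol_of_cuspSpan_of_goodSS [NeZero (W.conductorNorm ℤ)]
    {f : CuspForm (Gamma0 (W.conductorNorm ℤ)) 2} (hf : IsNewformOf W f) (hss : GoodSS W 2)
    (ha : W.frobeniusTrace 2 = 0)
    (hG : ∀ χ : Gamma0 (W.conductorNorm ℤ) → ZMod 2,
      (∀ γ δ : Gamma0 (W.conductorNorm ℤ), χ (γ * δ) = χ γ + χ δ) →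
      (∀ γ δ : Gamma0 (W.conductorNorm ℤ),
        periodFunctional (W.conductorNorm ℤ) γ = periodFunctional (W.conductorNorm ℤ) δ → χ γ = χ δ) →
      (∀ γ : Gamma0 (W.conductorNorm ℤ), (∃ k : ℕ, 1 ≤ k ∧ ((γ : SL(2, ℤ)) 1 1).natAbs = 4 ^ k) → χ γ = 0) →
      ∃ ψ : ZMod (W.conductorNorm ℤ) → ZMod 2,
        (∀ x y : ZMod (W.conductorNorm ℤ), IsUnit x → IsUnit y → ψ (x * y) = ψ x + ψ y) ∧
        ∀ γ : Gamma0 (W.conductorNorm ℤ), χ γ = ψ ((((γ : SL(2, ℤ)) 1 1 : ℤ) : ZMod (W.conductorNorm ℤ)))) :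
    ∃ γ : Gamma0 (W.conductorNorm ℤ), (∃ k : ℕ, 1 ≤ k ∧ ((γ : SL(2, ℤ)) 1 1).natAbs = 4 ^ k) ∧
      ∃ m : ℤ, Odd m ∧ (cuspSymbol f γ).re = m * (plusPeriod f / 2) :=
  exists_odd_re_cuspSymbol_of_cuspSpan f
    (Summit.BirchSwinnertonDyer.Rank1Residual.Additive.plusPeriod_pos_of_isNewformOf hf).ne' Nat.prime_two
    (not_two_dvd_conductorNorm_of_goodSS hss) (heckeT_two_eq_zero_smul_of_isNewformOf hf hss ha)
    (by decide) hG

end Habitat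

end Summit.BirchSwinnertonDyer.BirchSwinnertonDyer.Theorems.SignedMuAtTwo

end
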